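/-
PORT (pub-hodgecm2, COR-CM cell; seat b20, row Fg6 DERIVED-PKG) — RELOCATION FILE: the four "generic facts" of the stage-1 package
`HodgeCMPerL/HodgeCM/StubTree/Qw8Monomial.lean` §1 (ll. 100–124, md5 c9b36976df57: `Fact_dimProd`, `Fact_trTop`, `Fact_trTopCM`,
`trTopCM_of_trTop`) and `HodgeCMPerL/HodgeCM/StubTree/Qw8GysinDescentH0.lean` §1 (ll. 71–85: `Fact_unitH0`), declarations and
docstrings VERBATIM (namespace token `HodgeCM` ↦ `Summit.HodgeConjecture.CorCM`; one docstring added on `trTopCM_of_trTop`), gathered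
in one early statements file so that the model seats can discharge them for `Model.universeOf` before the `Qw8Monomial` /
`WeightDualUnit` ports land (those ports import this file instead of re-declaring).  They are the extra inputs of the package theorem
`Universe.weightDual_of_unitH0 : ModelAxioms → Fact_cupExterior → Fact_cupAssoc → Fact_dimProd → Fact_trTopCM → Fact_unitH0 → Fact_weightDual`
(PKG StubTree/WeightDualUnit.lean:327) by which row Fg6 `Fact_weightDual` is derived.  `chunk pNNNN Ln` in the docstrings = CHUNK index +
line of the held unpaginated text-store copy of the cited book (`page_kind: chunk`), NOT a printed page (package convention, kept verbatim).
-/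
import Summits.HodgeConjecture.CorCM.Proofs.CupC
import HarnessLib

/-!
# Four generic facts of the intended model: `dim (X × Y)`, the top-degree trace, the unit class of `H⁰`

Statements only (over the primitives of `Universe` plus the degree transport `castCoh` of
`Summit.HodgeConjecture.CorCM.Proofs.CupC`); none mentions algebraic cycles, Hodge classes, CM types or weights.  They enter
theorems as explicit hypotheses `(h : U.Fact_…)`; for the model of record `Model.universeOf` they are THEOREMS
(`Summit.HodgeConjecture.CorCM.Model.universeOf_fact_dimProd`, `…_trTop`, `…_trTopCM`, `…_unitH0`, file `CorCM/Model/GenericFacts.lean`).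

* `Fact_dimProd` — `dim (X × Y) = dim X + dim Y` [Görtz–Wedhorn I Prop. 5.37; Hartshorne I Ex. 3.15(d)].
* `Fact_trTop` ⊇ `Fact_trTopCM` (`trTopCM_of_trTop`) — the trace `∫_X : H^{2 dim X}(X, ℚ) → ℚ` is bijective (resp. injective on the
  CM products) [Voisin I Thm 5.30 + Rem. 5.31; Hatcher Thm 3.26(a), Cor. 3.39].
* `Fact_unitH0` — unit classes `1_X ∈ H⁰(X, ℚ)`, natural, left units for `∪`, spanning `H⁰` of every CM product [Hatcher §3.1–3.2].
-/

noncomputable section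

open scoped TensorProduct NumberField Classical

namespace Summit.HodgeConjecture.CorCM

open Literature.AlgebraicGeometry.Motives (CMType)

namespace Universe

variable (U : Universe)

/-! ## The generic facts (PKG `StubTree/Qw8Monomial.lean` §1, verbatim) -/

/-- **Fact D — dimension of a product.**  `dim (X × Y) = dim X + dim Y` for the (non-empty, irreducible) varieties of
the universe.  [Görtz–Wedhorn I, Prop. 5.37 (chunk p0164 L18–20); Hartshorne I Ex. 3.15(d) (chunk p0037 L1).] -/
def Fact_dimProd : Prop := ∀ X Y : U.Var, U.dim (U.prod X Y) = U.dim X + U.dim Y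

/-- **Fact T — the trace is an isomorphism in top degree.**  For the connected compact complex manifold `X(ℂ)` of
complex dimension `dim X`, integration `∫_X : H^{2 dim X}(X, ℚ) → ℚ` is bijective (`H^{2n}(X, ℚ) = ℚ · [X]^*`).
[Voisin I Thm 5.30 + Rem. 5.31 (chunk p0115 L24, L29), proof of Lemma 7.28 (chunk p0150 L9); Hatcher Thm 3.26(a)
(chunk p0304 L3–5), Cor. 3.39 (chunk p0322 L17).]  A hypothesis about the intended model (`Universe.Var` = connected
smooth projective complex varieties, `tr` = `(2πi)^{-dim} ∫`); false in the toy universe (`tr := 0`), like F6. -/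
def Fact_trTop : Prop := ∀ X : U.Var, Function.Bijective (U.tr X (2 * U.dim X))

/-- **`Fact_trTopCM` — the part of `Fact_trTop` the proofs below actually use**: on every CM product
`A′ = ∏_{j ≤ n} A_{(F,Θ_j)}` the top-degree trace `∫ : H^{2 dim A′}(A′, ℚ) → ℚ` is INJECTIVE (`dim_ℚ H^{2 dim A′}(A′, ℚ) ≤ 1`).
Same print sources as `Fact_trTop` (Voisin I Thm 5.30 + Rem 5.31, chunk p0115; Hatcher Thm 3.26(a) p0304, Cor 3.39 p0322: for a
closed connected orientable manifold `H^{top}(M; ℚ) ≅ ℚ`), specialised to the connected compact manifolds `A′(ℂ)`; implied by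
`Fact_trTop` (`trTopCM_of_trTop`).  Stated separately because, unlike the `∀ X : U.Var` form, it does not constrain the other
varieties of a universe (a toy universe may carry varieties with vanishing cohomology, where no trace is bijective — remark of
the qw8-g4 seat), so it is the form a non-vacuous exterior-algebra model can witness. -/
def Fact_trTopCM : Prop :=
  ∀ (F : CMField) (n : ℕ) (Θ : Fin (n + 1) → CMType F),
    Function.Injective (U.tr (U.cmProd F Θ) (2 * U.dim (U.cmProd F Θ)))

/-! ## The unit classes of `H⁰` (PKG `StubTree/Qw8GysinDescentH0.lean` §1, verbatim) -/

/-- **F-H0 (unit classes; class M).** There are classes `1_X ∈ H⁰(X, ℚ)` (`one X`), natural under pull-back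
(`f^* 1_Y = 1_X`), acting as the identity for the cup product (`1_X ∪ z = z`, up to the degree transport
`l = 0 + l`), and spanning `H⁰` of every CM product (`H⁰(A_Θ, ℚ) = ℚ · 1`, i.e. CM products are connected).
[Hatcher, *Algebraic Topology* (CUP 2002), cited by section / proposition (see the module docstring;
`chunk pNNNN` = internal locator in the held unpaginated text, not a page): §3.2, paragraph after Lemma 3.6
(identity `1 ∈ H⁰(X;R)`) [chunk p0266 L5]; §3.1 "Induced Homomorphisms" (cochain maps `f^♯`, whence
`f^* 1 = 1`) [chunk p0259 L5] and Prop. 3.10 (`f^*(α ∪ β) = f^*α ∪ f^*β`) [chunk p0270 L3]; §3.1, universal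
coefficients in degree `n = 0` (`H⁰(X;G)` = functions on path-components) [chunk p0256 L5]; CM products are
connected.] -/
def Fact_unitH0 : Prop :=
  ∃ one : ∀ X : U.Var, U.Coh X 0,
    (∀ (X Y : U.Var) (f : U.Mor X Y), U.pull f 0 (one Y) = one X) ∧
    (∀ (X : U.Var) (l : ℕ) (z : U.Coh X l), U.cup X 0 l (one X) z = U.castCoh X (Nat.zero_add l).symm z) ∧
    (∀ (F : CMField) (n : ℕ) (Θ : Fin (n + 1) → CMType F) (e : U.Coh (U.cmProd F Θ) 0),
      ∃ r : ℚ, e = r • one (U.cmProd F Θ))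

variable {U}

/-- `Fact_trTop` implies `Fact_trTopCM` (the CM products are varieties of the universe). [folklore] -/
theorem trTopCM_of_trTop (ht : U.Fact_trTop) : U.Fact_trTopCM := fun F _ Θ => (ht (U.cmProd F Θ)).1

end Universe

end Summit.HodgeConjecture.CorCM

end
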